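import Summits.BirchSwinnertonDyer.BirchSwinnertonDyer.Theorems.GoldfeldAllTwistsTwoConverseTwinOddTwoPrimesTwistSelmerDual
import Summits.BirchSwinnertonDyer.BirchSwinnertonDyer.Theorems.GoldfeldK12AdditiveTwoDescentFamiliesCorank
import Summits.BirchSwinnertonDyer.BirchSwinnertonDyer.Theorems.GoldfeldAllTwistsTwoConverseTwinSplitTwistTamagawa
import Summits.BirchSwinnertonDyer.BirchSwinnertonDyer.Theorems.GoldfeldGoodTwistsAllTwistsCells
import Summits.BirchSwinnertonDyer.BirchSwinnertonDyer.Theorems.GoldfeldAllTwistsTwoConverseTwinQuarterTraceIndexB4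
import HarnessLib

set_option linter.dupNamespace false -- namespace `…BirchSwinnertonDyer.BirchSwinnertonDyer…` is the cell's (D-0017 nested layout)
set_option autoImplicit false

/-!
# Twin″ (item 19140), LINE B⁗ object X0, part b: `corank_{ℤ₂} Sel_{2^∞}(49a1^{(−qp)}) = 1` and `r_an(49a1^{(−qp)}) = 1` on cells C4 ∪ C8
# — the discharge of X5α-χ's explicit hypothesis `h2` by descent, `2`-parity and Burungale–Castella–Skinner–Tian Thm. A

Cell `bsd-goldfeld`, seat `bsd-goldfeld-s1p-c3x` (gen 11); planner ORDER (cccxvii) «LINE B⁗ — TRANCHE 3», object X0, closing file. `--supports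
stmt-BirchSwinnertonDyer-19140` as a HELPER. Theses-free; theorems only; no definition, no `sorry`, no new fact. HONEST FRAMING: a twist-density-ZERO
two-prime family; the corank statement is modulo Modularity (`hnf`), CLTZ Thm. 1.2 (`h12`, the sign of `X₀(49)`) and `2`-parity (`hpar`,
Dokchitser–Dokchitser) — exactly the binders of the cell's `selmerCorank_two_eq_one_*` wrappers; the analytic-rank statement adds BCST Thm. A (`hBCST`,
the route's printed support item 20045). Nothing here proves BSD.

* `selmerCorank_two_eq_one_oddTwoPrimesTwist`: for `q ≡ 7 (8)` prime, `(q/7) = −1`, `p ≡ 5 (8)` prime, `(−7/p) = 1`, `(p/q) = −1`, every model `W` of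
  `49a1^{(−qp)}` has `corank_{ℤ₂} Sel_{2^∞}(W) = 1` — parts a1/a2 (`#S ≤ 2`, `#S′ ≤ 4`) in the cell's generic frame
  `selmerCorank_two_eq_one_of_smul_eq_of_card_mul_le` (`≤ 1` by descent, odd by the sign `−1` and `2`-parity).
* **`analyticRank_eq_one_oddTwoPrimesTwist_of_thmA`**: `r_an(X₀(49)^{(−qp)}) = 1` — the good-at-`2` global minimal model `G_k` (`d = −qp = 4k+1`,
  `…TwinSplitTwistTamagawa` §0: `j = −3375`, `Δ = −7³d⁶` odd) and `rankOneTwoConverse_goodCell_of_thmA`. This is X5α-χ's `h2` in tree shape.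
* **`bsdp_two_negTwoPrimesTwist_alpha_of_print'`**: T3-I-b's C4 closer with `h2` discharged — `BSD(W,2)` on cell C4 modulo X5α-χ's prints + `hKo` +
  `hpar` + `hBCST`.
References: [DokchitserDokchitserAnnals2010] Thm. 1.4; [BurungaleCastellaSkinnerTian2022] Thm. A, Rem. D; [SilvermanAEC2009] X.4.2, X.4.9, VII.5.1.
-/

noncomputable section

open scoped Classical

open WeierstrassCurve Literature.NumberTheory.EllipticCurves Literature.NumberTheory.EllipticCurves.ModularForms

namespace Summit.BirchSwinnertonDyer.BirchSwinnertonDyer.Theorems.GoldfeldGoodTwists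

section OddDescent
variable {q p : ℕ} [Fact q.Prime] [Fact p.Prime]

/-- **`corank_{ℤ₂} Sel_{2^∞}(W) = 1` for every model `W` of `49a1^{(−qp)}`** (`q ≡ 7 (8)` prime, `(q/7) = −1`; `p ≡ 5 (8)` prime, `(−7/p) = 1`;
`(p/q) = −1`), granted Modularity, CLTZ Thm. 1.2 at `R = 1` and `2`-parity: `#S·#S′ ≤ 2·4 = 8` (parts a1/a2) in the cell's generic frame.
[cite: DokchitserDokchitserAnnals2010, Thm. 1.4] [cite: SilvermanAEC2009, Thm. X.4.2(a), Prop. X.4.9] -/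
theorem selmerCorank_two_eq_one_oddTwoPrimesTwist (hnf : exists_isNewformOf) (h12 : CoatesLiTianZhai2015.thm12_fullBSD_twist)
    (hpar : ∀ (V : WeierstrassCurve ℚ) [V.IsElliptic], p_parity V 2)
    (hq8 : q % 8 = 7) (hq7 : jacobiSym q 7 = -1) (hp8 : p % 8 = 5) (hp7 : legendreSym p (-7) = 1) (hpq : jacobiSym p q = -1)
    (W : WeierstrassCurve ℚ) [W.IsElliptic] (C : VariableChange ℚ) (hC : C • W = cm7.quadraticTwist ((-((q : ℤ) * p) : ℤ) : ℚ)) :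
    W.selmerCorank 2 = 1 := by
  have hq : q.Prime := Fact.out
  have hp : p.Prime := Fact.out
  obtain ⟨⟨hq2, hp2, hqp, -, h7Q, h7P⟩, -⟩ := oddTwoPrimes_facts hq8 hq7 hp8 hp7 hpq
  have hsq : Squarefree (-((q : ℤ) * p)) := by
    have h := (Int.squarefree_natCast.mpr ((Nat.squarefree_mul ((Nat.coprime_primes hq hp).mpr hqp)).mpr
      ⟨hq.squarefree, hp.squarefree⟩))
    exact h.squarefree_of_dvd ⟨-1, by push_cast; ring⟩
  have h7 : ¬ (7 : ℤ) ∣ -((q : ℤ) * p) := by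
    rw [Int.dvd_neg]; exact not_seven_dvd_mul_oddTwoPrimes h7Q h7P
  have hd : -((q : ℤ) * p) < 0 := by
    have : (0 : ℤ) < q := by exact_mod_cast hq.pos
    have : (0 : ℤ) < p := by exact_mod_cast hp.pos
    nlinarith
  have hE := (smul_eq_twoTorsionModel_of_smul_eq_quadraticTwist (-((q : ℤ) * p)) W C hC).trans
    (show (⟨0, ((21 * (-((q : ℤ) * p)) : ℤ) : ℚ), 0, ((112 * (-((q : ℤ) * p)) ^ 2 : ℤ) : ℚ), 0⟩ : WeierstrassCurve ℚ) =
        ⟨0, ((-21 * ((q : ℤ) * p) : ℤ) : ℚ), 0, ((112 * ((q : ℤ) * p) ^ 2 : ℤ) : ℚ), 0⟩ by ext <;> push_cast <;> ring)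
  have hab := hab_inertTwist (m := q * p) (Nat.mul_pos hq.pos hp.pos)
  push_cast at hab
  have hS := card_twoIsogenySelmerGroup_oddTwoPrimesTwist_le hq8 hq7 hp8 hp7 hpq
  have hS' := card_twoIsogenySelmerGroup'_oddTwoPrimesTwist_le hq8 hq7 hp8 hp7 hpq
  exact selmerCorank_two_eq_one_of_smul_eq_of_card_mul_le hnf h12 hpar hsq h7 hd W C hC hab _ hE
    (by nlinarith [hS, hS', Nat.zero_le (twoIsogenySelmerGroup (-21 * ((q : ℤ) * p)) (112 * ((q : ℤ) * p) ^ 2)).card])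

/-- **`r_an(X₀(49)^{(−qp)}) = 1` on cells C4 ∪ C8** (same `q, p`), granted Modularity, CLTZ 1.2, `2`-parity and BCST Thm. A at `p = 2` (`hBCST`, item 20045's
constant): on the good-at-`2` global minimal model `G_k ⊗ ℚ` of `49a1^{(d)}`, `d = −qp = 4k+1` (`j = −3375`, `Δ = −7³d⁶` odd), `corank Sel_{2^∞} = 1`
and `rankOneTwoConverse_goodCell_of_thmA` give `r_an = 1`, an isogeny invariant. This is X5α-χ's hypothesis `h2` in tree shape.
[cite: BurungaleCastellaSkinnerTian2022, Thm. A (p. 326) and Rem. D (p. 327)] [cite: DokchitserDokchitserAnnals2010, Thm. 1.4] [cite: SilvermanAEC2009, VII.5 Prop. 5.1(a)] -/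
theorem analyticRank_eq_one_oddTwoPrimesTwist_of_thmA
    (hBCST : BurungaleCastellaSkinnerTian2022.thmA_analyticRank_eq_one_of_selmerCorank_eq_one) (hnf : exists_isNewformOf)
    (h12 : CoatesLiTianZhai2015.thm12_fullBSD_twist) (hpar : ∀ (V : WeierstrassCurve ℚ) [V.IsElliptic], p_parity V 2)
    (hq8 : q % 8 = 7) (hq7 : jacobiSym q 7 = -1) (hp8 : p % 8 = 5) (hp7 : legendreSym p (-7) = 1) (hpq : jacobiSym p q = -1) :
    (haveI := cm7.isElliptic_quadraticTwist (show (-((q : ℚ) * p)) ≠ 0 from neg_ne_zero.mpr (mul_ne_zero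
        (by exact_mod_cast (Fact.out : q.Prime).ne_zero) (by exact_mod_cast (Fact.out : p.Prime).ne_zero)));
      (cm7.quadraticTwist (-((q : ℚ) * p))).analyticRank) = 1 := by
  have hq : q.Prime := Fact.out
  have hp : p.Prime := Fact.out
  obtain ⟨⟨hq2, hp2, hqp, -, h7Q, h7P⟩, -⟩ := oddTwoPrimes_facts hq8 hq7 hp8 hp7 hpq
  have hd0 : (-((q : ℚ) * p)) ≠ 0 :=
    neg_ne_zero.mpr (mul_ne_zero (by exact_mod_cast hq.ne_zero) (by exact_mod_cast hp.ne_zero))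
  haveI := cm7.isElliptic_quadraticTwist hd0
  ------------------------------------------------------------------ `d = −qp = 4k + 1`
  obtain ⟨k, hk⟩ : ∃ k : ℤ, 4 * k + 1 = -((q : ℤ) * p) := by
    have hq' : (q : ℤ) % 8 = 7 := by exact_mod_cast hq8
    have hp' : (p : ℤ) % 8 = 5 := by exact_mod_cast hp8
    have h4 : (4 : ℤ) ∣ -((q : ℤ) * p) - 1 := by
      have : ((q : ℤ) * p) % 4 = 3 := by
        rw [Int.mul_emod, show (q : ℤ) % 4 = 3 by omega, show (p : ℤ) % 4 = 1 by omega]; norm_num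
      omega
    obtain ⟨k, hk⟩ := h4
    exact ⟨k, by linarith⟩
  have hsq : Squarefree (4 * k + 1) := by
    rw [hk]
    have h := (Int.squarefree_natCast.mpr ((Nat.squarefree_mul ((Nat.coprime_primes hq hp).mpr hqp)).mpr
      ⟨hq.squarefree, hp.squarefree⟩))
    exact h.squarefree_of_dvd ⟨-1, by push_cast; ring⟩
  ------------------------------------------------------------------ the good model `G = G_k ⊗ ℚ` and `C₀ • G = X₀(49)^{(−qp)}`
  have hCG : (⟨1, 0, -(1 / 2 : ℚ), 0⟩ : VariableChange ℚ) •
      (⟨1, -3 * k - 1, 0, -2 * (4 * k + 1) ^ 2, -(4 * k + 1) ^ 3⟩ : WeierstrassCurve ℤ).baseChange ℚ =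
        cm7.quadraticTwist (-((q : ℚ) * p)) := by
    rw [completeSquare_smul_goodModel_baseChange, hk]; push_cast; rfl
  haveI hGE : ((⟨1, -3 * k - 1, 0, -2 * (4 * k + 1) ^ 2, -(4 * k + 1) ^ 3⟩ : WeierstrassCurve ℤ).baseChange ℚ).IsElliptic := by
    rw [show (⟨1, -3 * k - 1, 0, -2 * (4 * k + 1) ^ 2, -(4 * k + 1) ^ 3⟩ : WeierstrassCurve ℤ).baseChange ℚ =
      (⟨1, 0, -(1 / 2 : ℚ), 0⟩ : VariableChange ℚ)⁻¹ • cm7.quadraticTwist (-((q : ℚ) * p)) by rw [← hCG, inv_smul_smul]]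
    infer_instance
  haveI := isGloballyMinimal_goodModel hsq
  ------------------------------------------------------------------ `j = −3375`, good reduction at `2`, `corank Sel_{2^∞} = 1`
  have hj' : ∀ (X : WeierstrassCurve ℚ) [X.IsElliptic], X = cm7.quadraticTwist (-((q : ℚ) * p)) → X.j = -3375 := by
    intro X _ hX; subst hX; rw [j_quadraticTwist _ hd0, j_cm7]
  have hj : ((⟨1, -3 * k - 1, 0, -2 * (4 * k + 1) ^ 2, -(4 * k + 1) ^ 3⟩ : WeierstrassCurve ℤ).baseChange ℚ).j = -3375 :=
    (variableChange_j _ (⟨1, 0, -(1 / 2 : ℚ), 0⟩ : VariableChange ℚ)).symm.trans (hj' _ hCG)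
  have hgood : ((⟨1, -3 * k - 1, 0, -2 * (4 * k + 1) ^ 2, -(4 * k + 1) ^ 3⟩ : WeierstrassCurve ℤ).baseChange ℚ).HasGoodReductionAtPrime 2 := by
    haveI : Fact (Nat.Prime 2) := ⟨Nat.prime_two⟩
    refine hasGoodReductionAtPrime_of_not_dvd _ 2 fun h2 ↦ ?_
    have hΔ := cast_minimalDiscriminantInt ((⟨1, -3 * k - 1, 0, -2 * (4 * k + 1) ^ 2, -(4 * k + 1) ^ 3⟩ : WeierstrassCurve ℤ).baseChange ℚ)
    have hΔ' : ((⟨1, -3 * k - 1, 0, -2 * (4 * k + 1) ^ 2, -(4 * k + 1) ^ 3⟩ : WeierstrassCurve ℤ).baseChange ℚ).Δ =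
        (((-(7 ^ 3 * (4 * k + 1) ^ 6) : ℤ)) : ℚ) := by
      rw [← goodModel_Δ k]; simp [WeierstrassCurve.baseChange, WeierstrassCurve.map_Δ]
    rw [hΔ'] at hΔ
    have hmin : minimalDiscriminantInt ((⟨1, -3 * k - 1, 0, -2 * (4 * k + 1) ^ 2, -(4 * k + 1) ^ 3⟩ : WeierstrassCurve ℤ).baseChange ℚ) =
        -(7 ^ 3 * (4 * k + 1) ^ 6) := by exact_mod_cast hΔ
    rw [hmin, Int.dvd_neg] at h2
    have h2' : (2 : ℤ) ∣ (4 * k + 1) ^ 6 := by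
      rcases (Int.prime_two.dvd_or_dvd h2) with h | h
      · exact absurd (Int.prime_two.dvd_of_dvd_pow h) (by norm_num)
      · exact h
    have h2'' := Int.prime_two.dvd_of_dvd_pow h2'
    omega
  have hsel : ((⟨1, -3 * k - 1, 0, -2 * (4 * k + 1) ^ 2, -(4 * k + 1) ^ 3⟩ : WeierstrassCurve ℤ).baseChange ℚ).selmerCorank 2 = 1 :=
    selmerCorank_two_eq_one_oddTwoPrimesTwist hnf h12 hpar hq8 hq7 hp8 hp7 hpq _ _ (by rw [hCG]; push_cast; rfl)
  ------------------------------------------------------------------ BCST Thm. A on the good cell, and isogeny invariance of `r_an`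
  have hG := rankOneTwoConverse_goodCell_of_thmA hBCST _ hj hgood hsel
  rw [← hG]
  exact (analyticRank_eq_of_isIsogenous' (isIsogenous_of_smul_eq hCG)).symm

/-- **THEOREM B⁗ on cell C4 WITHOUT `h2`: `BSD(W, 2)` for EVERY globally minimal elliptic `W/ℚ` with `C • W = X₀(49)^{(−2qp)}`**, `q ≡ 7 (mod 8)` prime,
`(q/7) = −1`; `p ≡ 5 (mod 8)` prime, `(−7/p) = +1`, `−7` NOT a fourth power mod `p`; `(p/q) = −1` — granted X5α-χ's prints, Kolyvagin `hKo`, `2`-parity `hpar`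
and BCST Thm. A `hBCST` (item 20045's constant): T3-I-b's `bsdp_two_negTwoPrimesTwist_alpha_of_print` with `h2` DISCHARGED by
`analyticRank_eq_one_oddTwoPrimesTwist_of_thmA`. Twist-density ZERO; twin″ is NOT closed; BSD is not proved by any of this.
[cite: Miller2011LMS, Def. 1.1] [cite: BurungaleCastellaSkinnerTian2022, Thm. A (p. 326) and Rem. D (p. 327)] [cite: DokchitserDokchitserAnnals2010, Thm. 1.4]
[cite: GrossZagier1986, Thm. I.(6.3) and V.§2] [cite: CoatesLiTianZhai2015, Thm. 1.2 (p. 359), 1.4 and 4.4] -/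
theorem bsdp_two_negTwoPrimesTwist_alpha_of_print' (hCST : CaiShuTian2014.thm11_ringClassChar)
    (hGZ : ∀ (N : ℕ) [NeZero N] (W : WeierstrassCurve ℚ) (K : Type) [Field K] [NumberField K], gross_zagier N W K)
    (h12 : CoatesLiTianZhai2015.thm12_fullBSD_twist) (h44 : CoatesLiTianZhai2015.thm44_ord_two_LAlg) (h14 : CoatesLiTianZhai2015.thm14_rankOne_twist)
    (hS31 : bsdTriple_of_rank_le_one_of_conductor_lt) (hnew : exists_isNewformOf) (hM : OptimalCurveManinCertificate cm7)
    (hBT : burungaleTian_analyticRank_eq_zero_of_selmerCorank_eq_zero_of_hasCM) (hBF : bsdTriple_of_hasCM_of_L_one_ne_zero)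
    (hGZK : rank_eq_analyticRank_of_analyticRank_le_one) (hEta : x049_heegner_norm_x_sub_two_not_mem)
    (hEta₀ : x049_x_sub_two_eq_etaQuotient) (hD : deuring_etaQuotient49_heegner_generates_conjPrime)
    (hKo : ∀ (N : ℕ) [NeZero N] (W : WeierstrassCurve ℚ) (K : Type) [Field K] [NumberField K], kolyvagin N W K)
    (hpar : ∀ (V : WeierstrassCurve ℚ) [V.IsElliptic], p_parity V 2)
    (hBCST : BurungaleCastellaSkinnerTian2022.thmA_analyticRank_eq_one_of_selmerCorank_eq_one)
    (hq8 : q % 8 = 7) (hq7 : jacobiSym q 7 = -1)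
    (hp8 : p % 8 = 5) (hp7 : legendreSym p (-7) = 1) (hα : ¬ ∃ x : ZMod p, x ^ 4 = -7) (hpq : jacobiSym (p : ℤ) q = -1)
    (W : WeierstrassCurve ℚ) [W.IsElliptic] [W.IsGloballyMinimal] (C : VariableChange ℚ)
    (hC : C • W = cm7.quadraticTwist (-(2 * (q : ℚ) * p))) : BSDp W 2 :=
  bsdp_two_negTwoPrimesTwist_alpha_of_print hCST hGZ h12 h44 h14 hS31 hnew hM hBT hBF hGZK hEta hEta₀ hD hKo Fact.out hq8 hq7 hp8 hp7 hα hpq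
    (analyticRank_eq_one_oddTwoPrimesTwist_of_thmA hBCST hnew h12 hpar hq8 hq7 hp8 hp7 hpq) W C hC

end OddDescent

end Summit.BirchSwinnertonDyer.BirchSwinnertonDyer.Theorems.GoldfeldGoodTwists

end
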